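import Summits.Schanuel.Schanuel.Theorems.SoloInformedRoyDegreeRange

/-!
# Roy's criterion at the corner: the phase diagram in the two condition exponents

Fix the admissible corner `t₀ = 1-η`, `t₁ = ½-η`, `s₀ = 1+η`, `s₁ = ½+η`, `u = 1+2η` of
`SoloInformedRoyTranslateSharp` (box `deg ≤ (N^{t₀}, N^{t₁})`, `H ≤ e^N`, precision `e^{-N^u}`) and
consider the two-parameter family of conditions

  `(b)(s₀', τ)` : `|(D^k Q_N)(my, α^m)| ≤ e^{-N^u}` for `k ≤ N^{s₀'}`, `m ≤ N^{τ}`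
  (`= RoyConditionB y α s₀' τ t₀ t₁ u`), `0 < s₀' ≤ 1+η`, `0 ≤ τ ≤ ½+η`.

`roy_phase_diagram`: for every `ε > 0` (`η = min(ε,¼)/13`),
* FREE PHASE: if `s₀' + τ < 3/2 - 4η` then `(b)(s₀', τ)` holds at EVERY point of `ℂ²`
  (`royConditionB_of_lt`: the condition count `N^{s₀'+τ}` is below the Dirichlet capacity);
* DECISIVE PHASE: if `1 < s₀'` and `½ - η ≤ τ` then `(b)(s₀', τ) ⟺ (a)` for every `(y, α) ∈ ℂ × ℂˣ`
  (`→`: degree-range criterion `royConditionA_of_royConditionB_deg`; `←`: Roy's Theorem 1 at the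
  corner and antitonicity of (b) in both exponents).
So the whole transition of Roy's criterion from "universally satisfiable" to "equivalent to
`α ∈ e^y·μ_∞`" takes place in the strip `3/2 - 4η ≤ s₀' + τ`, `s₀' ≤ 1 + η`, `τ ≤ ½ + η`, i.e.
within `O(η)` of the single point `(s₀', τ) = (1, ½)`: derivatives of order up to `N^{1+0}` at
translates up to `N^{1/2}` (the `X₁`-degree being `N^{1/2-η}`), against `N^{3/2-2η}` coefficients.

References: D. Roy, *An arithmetic criterion for the values of the exponential function*, Acta
Arith. 97 (2001) 183–194, Thm. 1 [Roy2001].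
-/

noncomputable section

open MvPolynomial Filter Complex
open Literature.NumberTheory.Transcendental

namespace Summit.Schanuel.Schanuel.Theorems

/-- Condition (b) is antitone in the derivative exponent `s₀` (fewer derivatives is weaker).
[cite: Roy2001, Thm. 1 (b)] -/
theorem royConditionB_anti_left (y α : ℂ) {s₀ s₀' s₁ t₀ t₁ u : ℝ} (hs : s₀' ≤ s₀)
    (h : RoyConditionB y α s₀ s₁ t₀ t₁ u) : RoyConditionB y α s₀' s₁ t₀ t₁ u := by
  unfold RoyConditionB at h ⊢
  filter_upwards [h, eventually_ge_atTop 1] with N hN hN1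
  obtain ⟨Q, hQ0, hd0, hd1, hH, hsmall⟩ := hN
  refine ⟨Q, hQ0, hd0, hd1, hH, fun k m hk hm => hsmall k m (hk.trans ?_) hm⟩
  exact Real.rpow_le_rpow_of_exponent_le (by exact_mod_cast hN1) hs

/-- **Phase diagram of Roy's criterion at the corner.** For every `ε > 0` there is `η > 0` with
`4η < ε` such that, at the admissible corner `(1+η, ½+η, 1-η, ½-η, 1+2η)` (where Theorem 1 holds),
the family `(b)(s₀', τ) = RoyConditionB y α s₀' τ (1-η) (½-η) (1+2η)` with `0 < s₀' ≤ 1+η`,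
`0 ≤ τ ≤ ½+η` is: universally true on `ℂ²` whenever `s₀' + τ < 3/2 - 4η`; equivalent to (a) on
`ℂ × ℂˣ` whenever `1 < s₀'` and `½ - η ≤ τ`. [cite: Roy2001, Thm. 1; folklore (Dirichlet)] -/
theorem roy_phase_diagram (ε : ℝ) (hε : 0 < ε) :
    ∃ η : ℝ, 0 < η ∧ 4 * η < ε ∧
      RoyAdmissible (1 + η) (1 / 2 + η) (1 - η) (1 / 2 - η) (1 + 2 * η) ∧
      (∀ y α : ℂ, α ≠ 0 →
        (RoyConditionB y α (1 + η) (1 / 2 + η) (1 - η) (1 / 2 - η) (1 + 2 * η) ↔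
          RoyConditionA y α)) ∧
      (∀ s₀' τ : ℝ, 0 < s₀' → s₀' ≤ 1 + η → 0 ≤ τ → τ ≤ 1 / 2 + η → s₀' + τ < 3 / 2 - 4 * η →
        ∀ y α : ℂ, RoyConditionB y α s₀' τ (1 - η) (1 / 2 - η) (1 + 2 * η)) ∧
      (∀ s₀' τ : ℝ, 1 < s₀' → s₀' ≤ 1 + η → 1 / 2 - η ≤ τ → τ ≤ 1 / 2 + η →
        ∀ y α : ℂ, α ≠ 0 →
          (RoyConditionB y α s₀' τ (1 - η) (1 / 2 - η) (1 + 2 * η) ↔ RoyConditionA y α)) := by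
  set ε' : ℝ := min ε (1 / 4) with hε'
  have hε'0 : 0 < ε' := lt_min hε (by norm_num)
  have hε'1 : ε' ≤ 1 / 4 := min_le_right _ _
  have hε'ε : ε' ≤ ε := min_le_left _ _
  set η : ℝ := ε' / 13 with hη
  have hη0 : 0 < η := by rw [hη]; positivity
  have hη13 : 13 * η = ε' := by rw [hη]; ring
  have hadm : RoyAdmissible (1 + η) (1 / 2 + η) (1 - η) (1 / 2 - η) (1 + 2 * η) :=
    royAdmissible_iff.mpr ⟨⟨by linarith, by linarith, by linarith, by linarith, by linarith⟩,
      ⟨by linarith, by linarith, by linarith, by linarith, by linarith, by linarith⟩,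
      ⟨by linarith, by linarith, by linarith⟩⟩
  have hthm1 : ∀ y α : ℂ, α ≠ 0 →
      (RoyConditionB y α (1 + η) (1 / 2 + η) (1 - η) (1 / 2 - η) (1 + 2 * η) ↔
        RoyConditionA y α) :=
    fun y α hα => (Roy2001_thm1_holds y α hα _ _ _ _ _ hadm).symm
  refine ⟨η, hη0, by linarith, hadm, hthm1, ?_, ?_⟩
  · intro s₀' τ hs₀' hs₀'1 hτ0 hτ1 hsum y α
    exact royConditionB_of_lt y α (by linarith) (by linarith) hs₀' hτ0 (by linarith)
      (by linarith) (by linarith) (by linarith) (by linarith)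
  · intro s₀' τ hs₀' hs₀'1 hτ0 hτ1 y α hα
    refine ⟨fun hb => ?_, fun ha => ?_⟩
    · exact royConditionA_of_royConditionB_deg hα (by linarith) (by linarith) (by linarith) hs₀'
        (by linarith) (by linarith) (by linarith) (royConditionB_mono y α hτ0 hb)
    · exact royConditionB_anti_left y α hs₀'1
        (royConditionB_mono y α hτ1 ((hthm1 y α hα).mpr ha))

end Summit.Schanuel.Schanuel.Theorems

end
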